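import Literature.InformationTheory.Coding.SourcePolarizationStepTransforms
import HarnessLib

/-!
# One step of source polarization, V: the lower bound `Z √(2 − Z²) ≤ Z(g⁻)`

Theorem-only companion of `Literature/InformationTheory/Coding/SourcePolarizationStep.lean`:
the Korada–Urbanke lower bound for the Bhattacharyya parameter of the minus transform of a binary
source with functional side information (uniform input, NO symmetry assumed),
`Z(g) √(2 − Z(g)²) ≤ Z(g⁻)`, equivalently `1 − Z(g⁻)² ≤ (1 − Z(g)²)²` — the mirror image of
`Z(g⁺) = Z(g)²` that drives polarization at the high-entropy end [Korada–Urbanke 2010, Lemma 17: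
`Z(W₁ ⊞ W₂)² ≥ Z(W₁)² + Z(W₂)² − Z(W₁)² Z(W₂)²`, here with `W₁ = W₂`; equality for binary
symmetric channels].

Proof (`bhatta_gMinus_ge`): with counts `N_b(y)`, `M = |Ω|`, `S = Σ_y √(N₀N₁) = M Z`, the
summand of `2M² Z(g⁻) = Σ_{y₁,y₂} √(N⁻₀ N⁻₁)` is the Euclidean norm of the vector
`(√(N₀N₁)(y₂) · (N₀+N₁)(y₁), √(N₀N₁)(y₁) · (N₀−N₁)(y₂))`; Minkowski's inequality in `ℝ²`
(`sqrt_sq_add_sq_sum_le`) over `y₁` bounds the inner sum below by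
`√(4M² N₀N₁ + S² (N₀−N₁)²)(y₂) = ‖(S (N₀+N₁)(y₂), 2√(M²−S²) √(N₀N₁)(y₂))‖`, and Minkowski over `y₂`
then gives `≥ ‖(2MS, 2S√(M²−S²))‖ = 2 S √(2M² − S²)`, i.e. `Z(g⁻) ≥ Z √(2 − Z²)`.

## References

* S. B. Korada, R. Urbanke, *Polar codes are optimal for lossy source coding*, IEEE Trans. IT 56
  (2010), Lemma 17.  bib `KoradaUrbanke2010`.
* E. Arıkan, *Channel polarization…*, IEEE Trans. IT 55 (2009), Prop. 5.  bib `Arikan2009`.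
-/

noncomputable section

namespace Literature.InformationTheory.Coding.Polar

open Finset Literature.InformationTheory.Entropy

variable {Ω : Type*} [Fintype Ω] {β : Type*} [DecidableEq β]

/-! ### Minkowski's inequality in `ℝ²` -/

/-- The triangle inequality for the Euclidean norm of `ℝ²`, coordinates spelled out:
`√((a+c)² + (b+d)²) ≤ √(a²+b²) + √(c²+d²)` (Cauchy–Schwarz `ac + bd ≤ √(a²+b²) √(c²+d²)`).
[folklore] -/
theorem sqrt_sq_add_sq_add_le (a b c d : ℝ) :
    Real.sqrt ((a + c) ^ 2 + (b + d) ^ 2) ≤ Real.sqrt (a ^ 2 + b ^ 2) + Real.sqrt (c ^ 2 + d ^ 2) := by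
  rw [Real.sqrt_le_iff]
  refine ⟨by positivity, ?_⟩
  have hcs : a * c + b * d ≤ Real.sqrt (a ^ 2 + b ^ 2) * Real.sqrt (c ^ 2 + d ^ 2) := by
    rw [← Real.sqrt_mul (by positivity)]
    exact (le_abs_self _).trans (Real.abs_le_sqrt (by nlinarith [sq_nonneg (a * d - b * c)]))
  nlinarith [Real.sq_sqrt (by positivity : 0 ≤ a ^ 2 + b ^ 2),
    Real.sq_sqrt (by positivity : 0 ≤ c ^ 2 + d ^ 2), hcs]

/-- **Minkowski's inequality in `ℝ²`** (finite sums): `√((Σ f)² + (Σ h)²) ≤ Σ_i √(f_i² + h_i²)`.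
[folklore] -/
theorem sqrt_sq_add_sq_sum_le {ι : Type*} (s : Finset ι) (f h : ι → ℝ) :
    Real.sqrt ((∑ i ∈ s, f i) ^ 2 + (∑ i ∈ s, h i) ^ 2) ≤
      ∑ i ∈ s, Real.sqrt (f i ^ 2 + h i ^ 2) := by
  classical
  induction s using Finset.induction_on with
  | empty => simp
  | insert a s ha ih =>
    rw [Finset.sum_insert ha, Finset.sum_insert ha, Finset.sum_insert ha]
    exact (sqrt_sq_add_sq_add_le _ _ _ _).trans (by linarith)

/-! ### The lower bound -/

/-- The Brahmagupta–Fibonacci identity behind the first Minkowski step: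
`(αδ + βγ)(βδ + αγ) = (√(γδ)(α+β))² + (√(αβ)(δ−γ))²` for nonnegative reals. [folklore] -/
theorem mul_eq_sq_add_sq {α β γ δ : ℝ} (hα : 0 ≤ α) (hβ : 0 ≤ β) (hγ : 0 ≤ γ) (hδ : 0 ≤ δ) :
    (α * δ + β * γ) * (β * δ + α * γ) =
      (Real.sqrt (γ * δ) * (α + β)) ^ 2 + (Real.sqrt (α * β) * (δ - γ)) ^ 2 := by
  rw [mul_pow, mul_pow, Real.sq_sqrt (mul_nonneg hγ hδ), Real.sq_sqrt (mul_nonneg hα hβ)]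
  ring

/-- **Korada–Urbanke's lower bound `Z(g) √(2 − Z(g)²) ≤ Z(g⁻)`** for the minus transform of a
binary source with functional side information (uniform input; no symmetry needed; equality for
binary symmetric channels).  Equivalently `1 − Z(g⁻)² ≤ (1 − Z(g)²)²`.
[cite: KoradaUrbanke2010, Lemma 17 (Z(W₁ ⊞ W₂)² ≥ Z₁² + Z₂² − Z₁²Z₂², case W₁ = W₂)] -/
theorem bhatta_gMinus_ge (g : ZMod 2 → Ω → β) :
    bhatta g * Real.sqrt (2 - bhatta g ^ 2) ≤ bhatta (gMinus g) := by
  rcases isEmpty_or_nonempty Ω with hΩ | hΩ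
  · simp [bhatta]
  have hMpos : (0 : ℝ) < Fintype.card Ω := by exact_mod_cast Fintype.card_pos
  set T := univ.image (fun p : ZMod 2 × Ω => g p.1 p.2) with hT
  set M : ℝ := (Fintype.card Ω : ℝ) with hMdef
  -- abbreviations: A y = N₀N₁, S = Σ √A = M Z
  set S : ℝ := ∑ y ∈ T, Real.sqrt (cnt g 0 y * cnt g 1 y) with hS
  have hZ : bhatta g = S / M := rfl
  have hS0 : 0 ≤ S := Finset.sum_nonneg fun _ _ => Real.sqrt_nonneg _
  have hSM : S ≤ M := by
    have h := bhatta_le_one g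
    rwa [hZ, div_le_one hMpos] at h
  have hsum0 : ∑ y ∈ T, (cnt g 0 y : ℝ) = M := sum_cnt_real g 0 _ fun w => mem_image_out g 0 w
  have hsum1 : ∑ y ∈ T, (cnt g 1 y : ℝ) = M := sum_cnt_real g 1 _ fun w => mem_image_out g 1 w
  set K : ℝ := Real.sqrt (M ^ 2 - S ^ 2) with hK
  have hK2 : K ^ 2 = M ^ 2 - S ^ 2 := Real.sq_sqrt (by nlinarith)
  -- Step 1: Minkowski over y₁, for each fixed y₂
  have step1 : ∀ y₂ : β,
      Real.sqrt ((2 * M * Real.sqrt (cnt g 0 y₂ * cnt g 1 y₂)) ^ 2 +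
          (S * ((cnt g 0 y₂ : ℝ) - cnt g 1 y₂)) ^ 2) ≤
        ∑ y₁ ∈ T, Real.sqrt (cnt (gMinus g) 0 (y₁, y₂) * cnt (gMinus g) 1 (y₁, y₂)) := by
    intro y₂
    have h := sqrt_sq_add_sq_sum_le T
      (fun y₁ => Real.sqrt (cnt g 0 y₂ * cnt g 1 y₂) * ((cnt g 0 y₁ : ℝ) + cnt g 1 y₁))
      (fun y₁ => Real.sqrt (cnt g 0 y₁ * cnt g 1 y₁) * ((cnt g 0 y₂ : ℝ) - cnt g 1 y₂))
    have hl : ∑ y₁ ∈ T, Real.sqrt (cnt g 0 y₂ * cnt g 1 y₂) * ((cnt g 0 y₁ : ℝ) + cnt g 1 y₁) =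
        2 * M * Real.sqrt (cnt g 0 y₂ * cnt g 1 y₂) := by
      rw [← Finset.mul_sum, Finset.sum_add_distrib, hsum0, hsum1]
      ring
    have hr : ∑ y₁ ∈ T, Real.sqrt (cnt g 0 y₁ * cnt g 1 y₁) * ((cnt g 0 y₂ : ℝ) - cnt g 1 y₂) =
        S * ((cnt g 0 y₂ : ℝ) - cnt g 1 y₂) := by
      rw [← Finset.sum_mul]
    rw [hl, hr] at h
    refine h.trans (le_of_eq (Finset.sum_congr rfl fun y₁ _ => ?_))
    rw [cnt_gMinus_zero, cnt_gMinus_one,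
      mul_eq_sq_add_sq (Nat.cast_nonneg _) (Nat.cast_nonneg _) (Nat.cast_nonneg _) (Nat.cast_nonneg _)]
    congr 1
    rw [mul_comm ((cnt g 1 y₂ : ℝ))]
  -- Step 2: rewrite the inner bound as the norm of `(S (N₀+N₁), 2K√(N₀N₁))`
  have step2 : ∀ y₂ : β,
      (2 * M * Real.sqrt (cnt g 0 y₂ * cnt g 1 y₂)) ^ 2 + (S * ((cnt g 0 y₂ : ℝ) - cnt g 1 y₂)) ^ 2 =
        (S * ((cnt g 0 y₂ : ℝ) + cnt g 1 y₂)) ^ 2 +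
          (2 * K * Real.sqrt (cnt g 0 y₂ * cnt g 1 y₂)) ^ 2 := by
    intro y₂
    have hA : Real.sqrt ((cnt g 0 y₂ : ℝ) * cnt g 1 y₂) ^ 2 = cnt g 0 y₂ * cnt g 1 y₂ :=
      Real.sq_sqrt (by positivity)
    linear_combination (4 * S ^ 2) * hA +
      (-4 * Real.sqrt ((cnt g 0 y₂ : ℝ) * cnt g 1 y₂) ^ 2) * hK2
  -- Step 3: Minkowski over y₂
  have step3 : Real.sqrt ((S * (2 * M)) ^ 2 + (2 * K * S) ^ 2) ≤
      ∑ y₂ ∈ T, Real.sqrt ((S * ((cnt g 0 y₂ : ℝ) + cnt g 1 y₂)) ^ 2 +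
        (2 * K * Real.sqrt (cnt g 0 y₂ * cnt g 1 y₂)) ^ 2) := by
    have h := sqrt_sq_add_sq_sum_le T (fun y₂ => S * ((cnt g 0 y₂ : ℝ) + cnt g 1 y₂))
      (fun y₂ => 2 * K * Real.sqrt (cnt g 0 y₂ * cnt g 1 y₂))
    have hl : ∑ y₂ ∈ T, S * ((cnt g 0 y₂ : ℝ) + cnt g 1 y₂) = S * (2 * M) := by
      rw [← Finset.mul_sum, Finset.sum_add_distrib, hsum0, hsum1]
      ring
    have hr : ∑ y₂ ∈ T, 2 * K * Real.sqrt (cnt g 0 y₂ * cnt g 1 y₂) = 2 * K * S := by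
      rw [← Finset.mul_sum]
    rwa [hl, hr] at h
  -- Step 4: evaluate the left end: `2 S √(2M² − S²)`
  have step4 : Real.sqrt ((S * (2 * M)) ^ 2 + (2 * K * S) ^ 2) = 2 * S * Real.sqrt (2 * M ^ 2 - S ^ 2) := by
    have h2 : (S * (2 * M)) ^ 2 + (2 * K * S) ^ 2 = (2 * S) ^ 2 * (2 * M ^ 2 - S ^ 2) := by
      linear_combination (4 * S ^ 2) * hK2
    rw [h2, Real.sqrt_mul (sq_nonneg _), Real.sqrt_sq (by positivity)]
  -- assemble
  have htot : 2 * S * Real.sqrt (2 * M ^ 2 - S ^ 2) ≤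
      ∑ p ∈ T ×ˢ T, Real.sqrt (cnt (gMinus g) 0 p * cnt (gMinus g) 1 p) := by
    rw [Finset.sum_product_right, ← step4]
    refine step3.trans (Finset.sum_le_sum fun y₂ _ => ?_)
    rw [← step2]
    exact step1 y₂
  rw [bhatta_eq_sum (gMinus g) _ (image_gMinus_subset g), card_bit_prod, ← hMdef, hZ,
    le_div_iff₀ (by positivity)]
  have hrt : Real.sqrt (2 - (S / M) ^ 2) = Real.sqrt (2 * M ^ 2 - S ^ 2) / M := by
    rw [show (2 : ℝ) - (S / M) ^ 2 = (2 * M ^ 2 - S ^ 2) / M ^ 2 by field_simp,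
      Real.sqrt_div' _ (sq_nonneg M), Real.sqrt_sq hMpos.le]
  rw [hrt]
  calc S / M * (Real.sqrt (2 * M ^ 2 - S ^ 2) / M) * (2 * (M * M)) =
      2 * S * Real.sqrt (2 * M ^ 2 - S ^ 2) := by
        field_simp
    _ ≤ _ := htot

/-! ### Packaged forms -/

/-- `Z(S⁺) = Z(S)²` for a packaged source. [cite: Arikan2009, Prop. 5 (Z(W⁺) = Z(W)²)] -/
theorem Src.zParam_plus_eq (S : Src) : S.plus.zParam = S.zParam ^ 2 := by
  rw [Src.zParam_plus, bhatta_gPlus]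
  rfl

/-- `Z(S⁻) ≤ 2 Z(S) − Z(S)²` for a packaged source. [cite: Arikan2009, Prop. 5 (Z(W⁻) ≤ 2Z(W) − Z(W)²)] -/
theorem Src.zParam_minus_le (S : Src) : S.minus.zParam ≤ 2 * S.zParam - S.zParam ^ 2 := by
  rw [Src.zParam_minus]
  exact bhatta_gMinus_le S.g

/-- `Z(S) √(2 − Z(S)²) ≤ Z(S⁻)` for a packaged source.
[cite: KoradaUrbanke2010, Lemma 17 (Z(W₁ ⊞ W₂)² ≥ Z₁² + Z₂² − Z₁²Z₂², case W₁ = W₂)] -/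
theorem Src.zParam_minus_ge (S : Src) :
    S.zParam * Real.sqrt (2 - S.zParam ^ 2) ≤ S.minus.zParam := by
  rw [Src.zParam_minus]
  exact bhatta_gMinus_ge S.g

end Literature.InformationTheory.Coding.Polar

end
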